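import Mathlib
import Summits.Schanuel.Schanuel.Theses.SheetDescent

/-!
# Birth skeleton for crux `TransPartRigidity` (stmt-Schanuel-13675) — route `SheetDescent`

Crux (route decl, FIXED): `Summit.Schanuel.Schanuel.Theses.SheetDescent.TransPartRigidity` —
Schanuel in all ranks `r < n` ⇒ a `ℚ`-linearly independent `x ∈ ℂⁿ` with `trdeg ℚ(x, eˣ) < n`
admits a MOVING or a SLIDING sheet deformation inside its `ℚ`-locus `Λₓ` (it is never
TRANSCENDENTALLY PLACED in its sheet family).

## The line — "count, then propagate" (the Pila–Zannier shape, both legs named)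

The route header records why this crux is the arithmetic core: o-minimal point counting bounds the
transcendentally placed graph points of any fixed variety by `c (log H)^κ` in the imaginary height
(the route's support item `TransPartSparse`, stmt-Schanuel-13588, Binyamini–Novikov–Zak 2022 =
arXiv:2202.05305 Thm 1 / Cor 1), "and exp has no Galois-orbit lower bound — the second leg of every
Pila–Zannier argument is missing".  This skeleton files exactly the two legs as named stubs and
kernel-checks that together they give the crux:

* `stub_transPartSparse` (S1 = the route's support item `TransPartSparse` BY NAME; XL, provable
  modulo the BNZ cite facts and ℝ_exp / restricted-Pfaffian cell decomposition not yet in tree):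
  for every Zariski-closed `V ⊆ ℂⁿ × ℂⁿ` the graph points `(x, eˣ) ∈ V` with `‖Im x‖_∞ ≤ H` that are
  transcendentally placed in `V` lie in a finite set of size `≤ c (log H)^κ`.
* `stub_orbitLowerBound : OrbitLowerBound` (S2 = the MISSING LEG, open — the analogue of the
  large-Galois-orbit / Masser–Zannier leg): a transcendentally placed first counterexample `x` PROPAGATES along its own
  `ℚ`-locus: for every `c, κ` there is a height `H ≥ 3` below which `Λₓ` carries more than
  `c (log H)^κ` graph points `(x', e^{x'})` that are themselves transcendentally placed in `Λₓ`.
  Why it might fail / why it is open: no mechanism produces other graph points on `Λₓ` (complex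
  conjugation is the only known non-trivial automorphism of `ℂ_exp`; the `2πiℤⁿ`-translates of
  `(x, eˣ)` need not lie on `Λₓ`, which is cut out over `ℚ`); like the crux it is implied by
  Schanuel (vacuous hypothesis) and irrefutable short of `¬Schanuel`.  It is strictly what the assembly consumes: quantifiers `∀ c κ, ∃ H, ∃ T` dual to S1's
  `∃ c κ, ∀ H, ∃ S`, no density exponent, no linear independence asked of the propagated points.

Composition `TransPartRigidity_of : TransPartSparse → OrbitLowerBound → TransPartRigidity`
(sorry-free and closed — axioms propext / Classical.choice / Quot.sound; hypotheses = the two stub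
types by name, conclusion = the route decl), and the registered target
`TransPartRigidity_skeleton : TransPartRigidity := TransPartRigidity_of stub_transPartSparse
stub_orbitLowerBound` (the crux BY NAME with no hypotheses; `sorryAx` enters exactly through the two
stubs — the shape `#h21_check_skeleton` accepts).  The composition: suppose a first
counterexample `x` admits neither a moving nor a sliding deformation; a deformation that is not
moving is sliding (`by_cases` on the moving clause), so `x` admits NO non-trivial deformation in
`Λₓ`, i.e. it is transcendentally placed in `V := Λₓ`; `Λₓ` is Zariski closed over `ℂ`
(`qLocus_isZariskiClosed`: the span of the base-changed rational relations, `zeroLocus_span` +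
`aeval_map_algebraMap`), so S1 gives `c, κ` and for every `H` a set `S` of size `≤ c (log H)^κ`
containing every transcendentally placed graph point of `V` of height `≤ H`; S2 gives `H` and a set
`T` of MORE than `c (log H)^κ` such points; `T ⊆ S` — contradiction.

## Vocabulary (§0; abbreviations only, each unfolding DEFINITIONALLY to the crux's inlined blocks)
`SchanuelBelow n`, `IsDeficient n x`, `qLocus n x` (= `Λₓ`), `sheetPoint`, `IsSheetDeformationIn n V x
a ξ ε` (the common block of the route's items with the `∈ V` clause of `TransPartSparse`),
`IsTransPlaced n V x` (no non-trivial sheet deformation inside `V`).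

## Disproof used / negatives
No `Cruxes/TransPartRigidity/Disproof.lean` exists yet (crux dir empty at registration); `ledger
negatives --problem Schanuel` = 2 entries (PolarPhantoms, `… trdeg ℚ(y, α) < n` for arbitrary
nonzero `α`), unrelated — no stub is an instance.  Refuter evidence on the item (2026-08-15):
`of_schanuel : Schanuel → TransPartRigidity` (so S2, like the crux, is Schanuel-implied) and
`sig_iff_collapsed` (moving ∨ sliding ⟺ some non-trivial deformation) — the collapse is re-proved
inline in `TransPartRigidity_of`.

## Barriers (route technique classes o-minimal-counting / ax-schanuel / wilkie-conjecture)
`Literature.Barriers.Schanuel.AxSchanuelFunctionalNotNumerical`: not touched (no functional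
transcendence in this line).  `…AlgebraicIndependenceOfLogarithms`: NOT evaded — it sits inside S2
(at `x = (1, πi)`, transcendentally placed by Lindemann per the route header, the crux IS `e ⊥ π`,
and S1 is a theorem-in-waiting, so S2 carries it); the skeleton only isolates it as the
propagation leg.
`…LinearSubgroupMethodLimit`, `…LargeTranscendenceDegree`: other technique classes, n/a.

Everything outside the two `stub_*` theorems is sorry-free (`lean check`: rc 0, sorries 2 = stubs 2).

## BC3 probes (registrar folder `bc/probe_*.lean`, each importing only the route file + §0; all FAIL
as required): `S1 → crux`, `S2 → crux` — `exact?` times out at `whnf` (400 000 and 4 000 000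
heartbeats) and reports "could not close the goal" once the crux binders are introduced; `simpa`:
`assumption` failed; `aesop`: failed after exhaustive search; `simpa [crux, §0 unfolded]` /
`unfold; simpa`: timeout.  `S1 → Schanuel`, `S2 → Schanuel`: `exact?` could not close the goal,
`simpa` / `aesop` / verbatim `first | exact? | simpa | aesop` unsolved goals.  Converses `crux → S1`,
`crux → S2` by the same closers also fail (S2 is nevertheless crux-implied by a three-line vacuity
argument, as every consequence of Schanuel is; it is used toward the crux, so this is the FLT ⇐
modularity shape, not decoration).
-/

noncomputable section

set_option linter.dupNamespace false

namespace Summit.Schanuel.Schanuel.Cruxes.TransPartRigidity.Birth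

open Summit.Schanuel.Schanuel.Theses.SheetDescent

/-! ### §0 Vocabulary of the line (abbreviations of the crux's inlined blocks) -/

/-- Schanuel's conjecture in every rank `r < n` — the standing hypothesis of the route's items. -/
def SchanuelBelow (n : ℕ) : Prop :=
  ∀ r < n, ∀ y : Fin r → ℂ, LinearIndependent ℚ y →
    (r : Cardinal) ≤ Algebra.trdeg ℚ
      ↥(IntermediateField.adjoin ℚ (Set.range y ∪ Set.range (Complex.exp ∘ y)))

/-- `x ∈ ℂⁿ` is DEFICIENT: `ℚ`-linearly independent with `trdeg ℚ(x, eˣ) < n`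
(a counterexample to Schanuel's conjecture at rank `n`). -/
def IsDeficient (n : ℕ) (x : Fin n → ℂ) : Prop :=
  LinearIndependent ℚ x ∧
    Algebra.trdeg ℚ ↥(IntermediateField.adjoin ℚ (Set.range x ∪ Set.range (Complex.exp ∘ x))) <
      (n : Cardinal)

/-- The `ℚ`-locus `Λₓ ⊆ ℂⁿ × ℂⁿ` of the graph point `(x, eˣ)`: the common zeros of the rational
polynomials vanishing at it. -/
def qLocus (n : ℕ) (x : Fin n → ℂ) : Set (Fin n ⊕ Fin n → ℂ) :=
  {P | ∀ f : MvPolynomial (Fin n ⊕ Fin n) ℚ,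
    MvPolynomial.aeval (Sum.elim x (Complex.exp ∘ x)) f = 0 → MvPolynomial.aeval P f = 0}

/-- The point of the translated graph reached at parameter `s`: `(ξ(s) + 2πi·a(s), e^{ξ(s)})`. -/
def sheetPoint (n : ℕ) (a : ℝ → Fin n → ℝ) (ξ : ℝ → Fin n → ℂ) (s : ℝ) : Fin n ⊕ Fin n → ℂ :=
  Sum.elim (fun i => ξ s i + 2 * (Real.pi : ℂ) * Complex.I * ((a s i : ℝ) : ℂ))
    (fun i => Complex.exp (ξ s i))

/-- `(a, ξ, ε)` is a SHEET DEFORMATION of `x` INSIDE `V`: a real-algebraic sheet path `a` and an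
analytic witness path `ξ` on `(0, ε)`, `(a, ξ)(0⁺) = (0, x)`, whose translated graph points stay in
`V` (verbatim the common block of the route's items, membership form of `TransPartSparse`). -/
def IsSheetDeformationIn (n : ℕ) (V : Set (Fin n ⊕ Fin n → ℂ)) (x : Fin n → ℂ)
    (a : ℝ → Fin n → ℝ) (ξ : ℝ → Fin n → ℂ) (ε : ℝ) : Prop :=
  0 < ε ∧ a 0 = 0 ∧ ξ 0 = x ∧ ContinuousWithinAt a (Set.Ici 0) 0 ∧
    ContinuousWithinAt ξ (Set.Ici 0) 0 ∧ AnalyticOnNhd ℝ a (Set.Ioo 0 ε) ∧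
    AnalyticOnNhd ℝ ξ (Set.Ioo 0 ε) ∧
    (∀ i, ∃ p : MvPolynomial (Fin 2) ℝ, p ≠ 0 ∧
      ∀ s ∈ Set.Ioo 0 ε, MvPolynomial.eval ![s, a s i] p = 0) ∧
    (∀ s ∈ Set.Ioo 0 ε, sheetPoint n a ξ s ∈ V)

/-- `x` is TRANSCENDENTALLY PLACED in `V`: it admits no non-trivial sheet deformation inside `V`
(neither moving nor sliding — the negated clause of `TransPartSparse`). -/
def IsTransPlaced (n : ℕ) (V : Set (Fin n ⊕ Fin n → ℂ)) (x : Fin n → ℂ) : Prop :=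
  ¬ ∃ (a : ℝ → Fin n → ℝ) (ξ : ℝ → Fin n → ℂ) (ε : ℝ),
      IsSheetDeformationIn n V x a ξ ε ∧ (∃ s ∈ Set.Ioo 0 ε, a s ≠ 0 ∨ ξ s ≠ x)

/-- **The propagation statement `OrbitLowerBound`** (type of the open stub S2, named so that the
skeleton theorem's hypotheses are constants): if Schanuel holds below rank `n` and `x ∈ ℂⁿ` is
deficient and transcendentally placed in its own `ℚ`-locus `Λₓ`, then for every `c, κ` there is a
height `H ≥ 3` and a finite set `T` of MORE than `c (log H)^κ` points `x'` with `(x', e^{x'}) ∈ Λₓ`,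
`|Im x'ᵢ| ≤ H`, each transcendentally placed in `Λₓ`. -/
def OrbitLowerBound : Prop :=
  ∀ (n : ℕ), SchanuelBelow n → ∀ x : Fin n → ℂ, IsDeficient n x →
    IsTransPlaced n (qLocus n x) x →
    ∀ (c : ℝ) (κ : ℕ), ∃ H : ℕ, 3 ≤ H ∧ ∃ T : Finset (Fin n → ℂ),
      c * Real.log H ^ κ < (T.card : ℝ) ∧
      ∀ x' ∈ T, Sum.elim x' (Complex.exp ∘ x') ∈ qLocus n x ∧ (∀ i, |(x' i).im| ≤ H) ∧
        IsTransPlaced n (qLocus n x) x'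

/-! ### §1 Registered stubs -/

/-- **S1 — polylog counting of the transcendental part** (= the route's support item
`TransPartSparse`, stmt-Schanuel-13588, BY NAME; XL; Binyamini–Novikov–Zak 2022, arXiv:2202.05305
Thm 1 / Cor 1, Pila–Wilkie 2006): for every Zariski-closed `V ⊆ ℂⁿ × ℂⁿ` there are `c, κ` such that
for `H ≥ 3` the graph points `(x, eˣ) ∈ V` with `|Im xᵢ| ≤ H` that are transcendentally placed in `V`
lie in a finite set of size `≤ c (log H)^κ`. -/
theorem stub_transPartSparse : TransPartSparse := by
  sorry

/-- **S2 — propagation of a transcendentally placed first counterexample (the missing orbit leg;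
OPEN).**  If Schanuel holds below rank `n` and `x ∈ ℂⁿ` is deficient and transcendentally placed in
its own `ℚ`-locus `Λₓ`, then for every `c, κ` there is a height `H ≥ 3` and a finite set `T` of
MORE than `c (log H)^κ` points `x'` with `(x', e^{x'}) ∈ Λₓ`, `|Im x'ᵢ| ≤ H`, each transcendentally
placed in `Λₓ`.  (Implied by Schanuel; with S1 it is the crux; it asks nothing else of the
propagated points.) -/
theorem stub_orbitLowerBound : OrbitLowerBound := by
  sorry

/-! ### §2 Sorry-free glue -/

/-- The `ℚ`-locus is Zariski closed over `ℂ`: it is cut out by the `ℂ`-span of the base-changed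
rational relations of `(x, eˣ)`. -/
theorem qLocus_isZariskiClosed (n : ℕ) (x : Fin n → ℂ) :
    ∃ I : Ideal (MvPolynomial (Fin n ⊕ Fin n) ℂ), qLocus n x = MvPolynomial.zeroLocus ℂ I := by
  refine ⟨Ideal.span ((MvPolynomial.map (algebraMap ℚ ℂ)) ''
    {f : MvPolynomial (Fin n ⊕ Fin n) ℚ |
      MvPolynomial.aeval (Sum.elim x (Complex.exp ∘ x)) f = 0}), ?_⟩
  rw [MvPolynomial.zeroLocus_span]
  ext P
  simp only [qLocus, Set.mem_setOf_eq, Set.forall_mem_image, MvPolynomial.aeval_map_algebraMap]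

/-- A deformation inside `Λₓ` that is not moving is sliding; hence "neither moving nor sliding"
means transcendentally placed (the refuter's `sig_iff_collapsed`, one direction, inlined). -/
theorem isTransPlaced_of_not_moving_or_sliding (n : ℕ) (x : Fin n → ℂ)
    (h : ¬ ((∃ (a : ℝ → Fin n → ℝ) (ξ : ℝ → Fin n → ℂ) (ε : ℝ),
        IsSheetDeformationIn n (qLocus n x) x a ξ ε ∧ (∃ s ∈ Set.Ioo 0 ε, a s ≠ 0 ∨ ξ s ≠ x) ∧
        (∀ q : Fin n → ℤ, (∃ c : ℂ, ∀ s ∈ Set.Ioo 0 ε, ∑ i, (q i : ℂ) * ξ s i = c) →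
          (∃ c : ℝ, ∀ s ∈ Set.Ioo 0 ε, ∑ i, (q i : ℝ) * a s i = c))) ∨
      (∃ (a : ℝ → Fin n → ℝ) (ξ : ℝ → Fin n → ℂ) (ε : ℝ),
        IsSheetDeformationIn n (qLocus n x) x a ξ ε ∧
        (∃ q : Fin n → ℤ, (∃ c : ℂ, ∀ s ∈ Set.Ioo 0 ε, ∑ i, (q i : ℂ) * ξ s i = c) ∧
          ¬ (∃ c : ℝ, ∀ s ∈ Set.Ioo 0 ε, ∑ i, (q i : ℝ) * a s i = c))))) :
    IsTransPlaced n (qLocus n x) x := by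
  rintro ⟨a, ξ, ε, hdef, hnt⟩
  apply h
  by_cases hmov : ∀ q : Fin n → ℤ, (∃ c : ℂ, ∀ s ∈ Set.Ioo 0 ε, ∑ i, (q i : ℂ) * ξ s i = c) →
      (∃ c : ℝ, ∀ s ∈ Set.Ioo 0 ε, ∑ i, (q i : ℝ) * a s i = c)
  · exact Or.inl ⟨a, ξ, ε, hdef, hnt, hmov⟩
  · obtain ⟨q, hq⟩ := not_forall.mp hmov
    exact Or.inr ⟨a, ξ, ε, hdef, q, (Classical.not_imp.mp hq).1, (Classical.not_imp.mp hq).2⟩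

/-! ### §3 The skeleton theorem — concludes the crux BY NAME -/

/-- **Skeleton.**  Polylog counting of the transcendental part (S1 = `TransPartSparse`) and
propagation of a transcendentally placed first counterexample (S2) give `TransPartRigidity`. -/
theorem TransPartRigidity_of : TransPartSparse → OrbitLowerBound → TransPartRigidity := by
  intro hS hO n hbelow x hx hlt
  by_contra hnot
  -- (1) `x` is transcendentally placed in its own `ℚ`-locus
  have hplaced : IsTransPlaced n (qLocus n x) x :=
    isTransPlaced_of_not_moving_or_sliding n x hnot
  -- (2) polylog counting on `V := Λₓ`
  obtain ⟨c, κ, hcount⟩ := hS n (qLocus n x) (qLocus_isZariskiClosed n x)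
  -- (3) propagation beats the count at some height `H`
  obtain ⟨H, hH, T, hcard, hT⟩ := hO n hbelow x ⟨hx, hlt⟩ hplaced c κ
  obtain ⟨S, hScard, hSmem⟩ := hcount H hH
  have hTS : T ⊆ S := by
    intro x' hx'
    obtain ⟨hmem, him, hplaced'⟩ := hT x' hx'
    exact hSmem x' hmem him hplaced'
  have hle : (T.card : ℝ) ≤ S.card := by exact_mod_cast Finset.card_le_card hTS
  linarith

/-- **Registered target of the skeleton** — the crux BY NAME with no hypotheses: `TransPartRigidity_of`
applied to the two declared stubs (`#print axioms` reaches `sorryAx` exactly through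
`stub_transPartSparse` and `stub_orbitLowerBound`; everything else is closed). -/
theorem TransPartRigidity_skeleton : TransPartRigidity :=
  TransPartRigidity_of stub_transPartSparse stub_orbitLowerBound

end Summit.Schanuel.Schanuel.Cruxes.TransPartRigidity.Birth
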